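import Mathlib
import Summits.MatrixMultiplication.MatrixMultiplication.Theorems.SoloBlindFlatWrapper

/-!
# K♭ / E♭ at bounded corank from a MODE-WISE flat certificate

`soloBlind_flat_of_certified` consumes the flat certificate in both modes at once.  Since the mode-E
certificate is much costlier to evaluate than the mode-K one, this file separates the modes: a
certificate `soloBlindFlatCertifiedMode c S modeE` for ONE mode gives CONJECTURE K♭ (mode K,
`soloBlind_kflat_of_certifiedK`) resp. CONJECTURE E♭ for `H`-good targets (mode E,
`soloBlind_eflat_of_certifiedE`) at corank at most `c` in every rank.  The induction is that of
`SoloBlindFlatWrapper` verbatim; plain Lean.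
-/

namespace Summit.MatrixMultiplication.MatrixMultiplication.Theorems

open Finset Module

/-- THE MODE-WISE FLAT CERTIFICATE up to `c` letters at scale `S`. -/
def soloBlindFlatCertifiedMode (c S : ℕ) (modeE : Bool) : Prop :=
  ∀ m ≤ c, ∃ n, 0 < n ∧ ∀ i < n, soloBlindFlatCertCanon m n i S modeE = true

/-- The two-mode certificate gives each mode-wise one. -/
theorem soloBlind_flatCertifiedMode_of {c S : ℕ} (h : soloBlindFlatCertified c S) (modeE : Bool) :
    soloBlindFlatCertifiedMode c S modeE := fun m hm => h m hm modeE

variable {G : Type*} [AddCommGroup G] [DecidableEq G] {ι : Type*} [DecidableEq ι]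

/-- K♭ (mode K) OR E♭ (mode E) AT CORANK AT MOST `c` FROM A MODE-WISE FLAT CERTIFICATE (every rank),
by strong induction on the size of the index set (as in `soloBlind_flat_of_certified`). -/
theorem soloBlind_flat_of_certifiedMode [Module (ZMod 3) G] (modeE : Bool) {c Sc : ℕ}
    (hcert : soloBlindFlatCertifiedMode c Sc modeE)
    (hSc : c + 1 ≤ Sc) (h : ι → G) : ∀ (N : ℕ) (S₀ : Finset ι), S₀.card ≤ N →
      S₀.card ≤ finrank (ZMod 3) (Submodule.span (ZMod 3) (h '' (↑S₀ : Set ι))) + c →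
      (∀ T ⊆ S₀, T.Nonempty → ∑ i ∈ T, h i ≠ 0) → ∀ τ : G,
      (modeE = false → soloBlindKFlatAt h S₀ τ) ∧
        (modeE = true → (∀ T ⊆ S₀, ∑ i ∈ T, h i ≠ τ + τ) → soloBlindEFlatAt h S₀ τ) := by
  intro N
  induction N with
  | zero =>
    intro S₀ hN _ _ τ
    have hS : S₀ = ∅ := Finset.card_eq_zero.mp (Nat.le_zero.mp hN)
    have hR : (soloBlindSeqRepAll h S₀ τ).card ≤ 1 := by
      unfold soloBlindSeqRepAll
      rw [hS, Finset.powerset_empty]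
      exact (Finset.card_filter_le _ _).trans (by rw [Finset.card_singleton])
    exact ⟨fun _ => soloBlind_kflat_of_card_le_one hR, fun _ _ => soloBlind_eflat_of_card_le_one hR⟩
  | succ N ih =>
    intro S₀ hN hc zsf τ
    -- at most one representation: settled directly
    by_cases hR : (soloBlindSeqRepAll h S₀ τ).card ≤ 1
    · exact ⟨fun _ => soloBlind_kflat_of_card_le_one hR, fun _ _ => soloBlind_eflat_of_card_le_one hR⟩
    -- reduction to a smaller index set containing the core
    have reduce : ∀ S' ⊆ S₀, soloBlindCore h S₀ τ ⊆ S' → S'.card ≤ N →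
        S'.card ≤ finrank (ZMod 3) (Submodule.span (ZMod 3) (h '' (↑S' : Set ι))) + c →
        (modeE = false → soloBlindKFlatAt h S₀ τ) ∧
          (modeE = true → (∀ T ⊆ S₀, ∑ i ∈ T, h i ≠ τ + τ) → soloBlindEFlatAt h S₀ τ) := by
      intro S' hS' hcoreS' hN' hc'
      obtain ⟨hK, hE⟩ := ih S' hN' hc' (fun T hT hne => zsf T (hT.trans hS') hne) τ
      exact ⟨fun hf => (soloBlind_kflatAt_restrict hcoreS' hS').mp (hK hf), fun ht hgood =>
        (soloBlind_eflatAt_restrict hcoreS' hS').mp (hE ht fun T hT => hgood T (hT.trans hS'))⟩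
    -- a maximal independent block
    obtain ⟨B, hBS, hliOn, hrankB⟩ := soloBlind_exists_indepOn_spanning h S₀
    have hli : LinearIndependent (ZMod 3) (fun i : B => h i) := hliOn
    have hdist : ∀ A ⊆ B, ∀ A' ⊆ B, ∑ i ∈ A, h i = ∑ i ∈ A', h i → A = A' :=
      soloBlind_sumDistinct_of_linearIndependent (R := ZMod 3)
        (soloBlind_coeffIndep_of_linearIndepOn hliOn)
    have hBrank : B.card ≤ finrank (ZMod 3) (Submodule.span (ZMod 3) (h '' (↑B : Set ι))) := by
      rw [show h '' (↑B : Set ι) = Set.range (fun i : B => h i) by ext; simp,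
        finrank_span_eq_card hli, Fintype.card_coe]
    have hXc : (S₀ \ B).card ≤ c := by
      rw [Finset.card_sdiff_of_subset hBS]
      omega
    have hcoreS := soloBlind_core_subset h S₀ τ
    -- case: the core misses the block
    by_cases hcoreB : ¬ (soloBlindCore h S₀ τ ∩ B).Nonempty
    · have hcoreX : soloBlindCore h S₀ τ ⊆ S₀ \ B := fun y hy =>
        Finset.mem_sdiff.mpr ⟨hcoreS hy, fun hyB => hcoreB ⟨y, Finset.mem_inter.mpr ⟨hy, hyB⟩⟩⟩
      by_cases heq : soloBlindCore h S₀ τ = S₀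
      · -- then `B = ∅`, the span has rank zero and `S₀ = ∅`
        have hB : B = ∅ := by
          rw [Finset.eq_empty_iff_forall_notMem]
          intro y hyB
          have hy : y ∈ S₀ \ B := hcoreX (by rw [heq]; exact hBS hyB)
          exact (Finset.mem_sdiff.mp hy).2 hyB
        rw [hB, Finset.card_empty, Nat.le_zero] at hrankB
        have hS := soloBlind_eq_empty_of_finrank_zero hrankB zsf
        exfalso
        apply hR
        unfold soloBlindSeqRepAll
        rw [hS, Finset.powerset_empty]
        exact (Finset.card_filter_le _ _).trans (by rw [Finset.card_singleton])
      · have hss : soloBlindCore h S₀ τ ⊂ S₀ := Finset.ssubset_iff_subset_ne.mpr ⟨hcoreS, heq⟩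
        have hlt := Finset.card_lt_card hss
        exact reduce _ hcoreS (subset_refl _) (by omega)
          ((Finset.card_le_card hcoreX).trans (hXc.trans (Nat.le_add_left _ _)))
    rw [not_not] at hcoreB
    -- case: an unused letter
    by_cases hused : ¬ ∀ y ∈ S₀ \ B, y ∈ soloBlindCore h S₀ τ
    · obtain ⟨y, hyX, hycore⟩ : ∃ y ∈ S₀ \ B, y ∉ soloBlindCore h S₀ τ := by
        by_contra hcon
        exact hused fun y hy => by_contra fun hyc => hcon ⟨y, hy, hyc⟩
      obtain ⟨hyS, hyB⟩ := Finset.mem_sdiff.mp hyX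
      have hBS' : B ⊆ S₀.erase y := fun z hz =>
        Finset.mem_erase.mpr ⟨fun hzy => hyB (hzy ▸ hz), hBS hz⟩
      haveI := FiniteDimensional.span_of_finite (ZMod 3) ((S₀.erase y).finite_toSet.image h)
      have hmono : finrank (ZMod 3) (Submodule.span (ZMod 3) (h '' (↑B : Set ι))) ≤
          finrank (ZMod 3) (Submodule.span (ZMod 3) (h '' (↑(S₀.erase y) : Set ι))) :=
        Submodule.finrank_mono (Submodule.span_mono (Set.image_mono (Finset.coe_subset.mpr hBS')))
      have hcard := Finset.card_erase_of_mem hyS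
      have hsd := Finset.card_sdiff_of_subset hBS
      exact reduce (S₀.erase y) (Finset.erase_subset y S₀)
        (fun z hz => Finset.mem_erase.mpr ⟨fun hzy => hycore (hzy ▸ hz), hcoreS hz⟩)
        (by omega) (by omega)
    rw [not_not] at hused
    -- main case: canonical relabelling of the letters, then the certificate
    obtain ⟨x, hx⟩ := soloBlind_exists_enum (S₀ \ B)
    obtain ⟨π, hπ⟩ := soloBlind_exists_canon (S₀ \ B).card (soloBlindExactFam h B x τ)
    have hx' : Finset.univ.map (π.toEmbedding.trans x) = S₀ \ B := by
      rw [soloBlind_map_perm_enum, hx]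
    have hxB' : ∀ a, (π.toEmbedding.trans x) a ∉ B := fun a ha => by
      have hxa : (π.toEmbedding.trans x) a ∈ Finset.univ.map (π.toEmbedding.trans x) :=
        Finset.mem_map_of_mem _ (Finset.mem_univ a)
      rw [hx'] at hxa
      exact (Finset.mem_sdiff.mp hxa).2 ha
    have hS₀ : B ∪ Finset.univ.map (π.toEmbedding.trans x) = S₀ := by
      rw [hx', Finset.union_sdiff_of_subset hBS]
    have zsf' : ∀ T ⊆ B ∪ Finset.univ.map (π.toEmbedding.trans x), T.Nonempty → ∑ i ∈ T, h i ≠ 0 := by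
      rw [hS₀]; exact zsf
    have hu' : (soloBlindCore h (B ∪ Finset.univ.map (π.toEmbedding.trans x)) τ ∩ B).Nonempty := by
      rw [hS₀]; exact hcoreB
    by_cases h2 : ¬ 2 ≤ (soloBlindExactFam h B (π.toEmbedding.trans x) τ).length
    · exfalso
      apply hR
      rw [← hS₀]
      exact soloBlind_repAll_card_le_one_of_length hdist _ (by omega)
    rw [not_not] at h2
    have hadm : soloBlindFlatAdmissible (S₀ \ B).card
        (soloBlindExactFam h B (π.toEmbedding.trans x) τ) = true := by
      unfold soloBlindFlatAdmissible
      rw [Bool.and_eq_true, decide_eq_true_eq, List.all_eq_true]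
      refine ⟨h2, fun a ha => ?_⟩
      rw [List.mem_range] at ha
      rw [List.any_eq_true]
      have hxa : (π.toEmbedding.trans x) ⟨a, ha⟩ ∈ soloBlindCore h
          (B ∪ Finset.univ.map (π.toEmbedding.trans x)) τ := by
        have hmem : (π.toEmbedding.trans x) ⟨a, ha⟩ ∈ Finset.univ.map (π.toEmbedding.trans x) :=
          Finset.mem_map_of_mem _ (Finset.mem_univ _)
        rw [hx'] at hmem
        rw [hS₀]
        exact hused _ hmem
      obtain ⟨M, hM, hb⟩ := soloBlind_used_of_mem_core _ hxB' hxa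
      exact ⟨M, hM, hb⟩
    have hcanon : soloBlindCanonB (S₀ \ B).card (soloBlindPermTabs (S₀ \ B).card)
        (soloBlindExactFam h B (π.toEmbedding.trans x) τ) = true := by
      rw [soloBlindExactFam_perm]
      exact hπ
    have hsub := soloBlind_exactFam_sublist h B (π.toEmbedding.trans x) τ
    obtain ⟨n, hn, hall⟩ := hcert _ hXc
    have hcheck := soloBlind_flatCertCanon_extract hn hall hsub hadm hcanon
    refine ⟨fun hf => ?_, fun ht hgood => ?_⟩
    · subst hf
      have r := soloBlind_flatSound_K hli hdist _ hxB' τ zsf' (S := Sc) (by omega) hadm hcheck hu'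
      rwa [hS₀] at r
    · subst ht
      have hgood' : ∀ T ⊆ B ∪ Finset.univ.map (π.toEmbedding.trans x), ∑ i ∈ T, h i ≠ τ + τ := by
        rw [hS₀]; exact hgood
      have r := soloBlind_flatSound_E hli hdist _ hxB' τ zsf' hgood' (S := Sc) (by omega) hadm hcheck hu'
      rwa [hS₀] at r

/-- CONJECTURE K♭ AT CORANK AT MOST `c` from a mode-K certificate (rank form). -/
theorem soloBlind_kflat_of_certifiedK [Module (ZMod 3) G] {c Sc : ℕ}
    (hcert : soloBlindFlatCertifiedMode c Sc false) (hSc : c + 1 ≤ Sc) {h : ι → G} {S : Finset ι}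
    (hc : S.card ≤ finrank (ZMod 3) (Submodule.span (ZMod 3) (h '' (↑S : Set ι))) + c)
    (zsf : ∀ T ⊆ S, T.Nonempty → ∑ i ∈ T, h i ≠ 0) (τ : G) : soloBlindKFlatAt h S τ :=
  (soloBlind_flat_of_certifiedMode false hcert hSc h S.card S le_rfl hc zsf τ).1 rfl

/-- CONJECTURE E♭ AT CORANK AT MOST `c` from a mode-E certificate (rank form, `H`-good `τ`). -/
theorem soloBlind_eflat_of_certifiedE [Module (ZMod 3) G] {c Sc : ℕ}
    (hcert : soloBlindFlatCertifiedMode c Sc true) (hSc : c + 1 ≤ Sc) {h : ι → G} {S : Finset ι}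
    (hc : S.card ≤ finrank (ZMod 3) (Submodule.span (ZMod 3) (h '' (↑S : Set ι))) + c)
    (zsf : ∀ T ⊆ S, T.Nonempty → ∑ i ∈ T, h i ≠ 0) {τ : G} (hgood : ∀ T ⊆ S, ∑ i ∈ T, h i ≠ τ + τ) :
    soloBlindEFlatAt h S τ :=
  (soloBlind_flat_of_certifiedMode true hcert hSc h S.card S le_rfl hc zsf τ).2 rfl hgood

end Summit.MatrixMultiplication.MatrixMultiplication.Theorems
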